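import Summits.BirchSwinnertonDyer.BirchSwinnertonDyer.Theses.TameQuarticManinParity
import Summits.BirchSwinnertonDyer.BirchSwinnertonDyer.Theorems.TameQuarticManinParityFramedRepConjugateOfCongruentFrobenius
import Summits.BirchSwinnertonDyer.BirchSwinnertonDyer.Theorems.TameQuarticManinParityModThreeFrobeniusTwins
import Literature.NumberTheory.EllipticCurves.NewformGaloisRepResidualOfThm61Proofs
import Literature.NumberTheory.Automorphic.ReciprocityGLnProofs
import Literature.NumberTheory.Automorphic.CDTTheorem722SerreProofs
import HarnessLib

/-!
# Route `TameQuarticManinParity`: LINE 35 glue BY NAME — R35 (stmt-BirchSwinnertonDyer-23871), RIG35 (stmt-23870) PROVED,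
# G35 (stmt-23872)

Seat `bsd-line-ttd-p1` g12 (explicit-unit on the planner-of-record's TQMP LINE 35, bsd-idea-3 g10), landing the pen's
kernel-checked glue of `line35/Sketch35.lean` / `LINE35_COMPLETE.lean` (critic VERDICT #212 PASS) verbatim up to
namespace / names / docstrings, at the pen's explicit request (ideators INBOX 2026-08-29T00:55:21Z), on top of the landed
X35 `framedRepConjugateOfCongruentFrobenius_proof` (p684226):

* `torsionRepRigid_of_framedRepConjugate : TorsionRepRigidOfFramedRepConjugate` — **R35** (stmt-23871): X35 ⇒ RIG35, the
  `W`-side inputs being tree theorems (unramified at good `v ∤ 3`, Frobenius polynomial `X² − a_p(W) X + p`, `p ∣ N_W ↔ bad`,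
  base change, absolute irreducibility of `ρ̄_{W,3}` from oddness);
* `torsionRepRigidOfCongruentFrobenius_proof : TorsionRepRigidOfCongruentFrobenius` — **RIG35** (stmt-23870) PROVED outright;
* `torsionRepOfEverywhereCongruentNewform_of_rigid : TorsionRepOfEverywhereCongruentNewformOfRigid` — **G35** (stmt-23872):
  Deligne's theorem as the tree's named fact `DeligneSerre1974.thm61_exists_adicGaloisRep` ⇒ RIG35 ⇒ CONG∞;
* the «_of_thm61» corollaries (CONG∞ stmt-23841 and CONG33 stmt-23817 conditional on that one named fact) live in the
  companion file `TameQuarticManinParityCongruentNewformCarriesTorsionRepOfThm61` (`--supports`, items stay open).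

THEOREMS ONLY: no definition, no named fact, no `sorry`.  No summit is proved; BSD is NOT proved; MS (stmt-23367) and the
organ (stmt-24498) remain OPEN.
-/

set_option autoImplicit false
-- D-0017: single-problem summit, so `Summit.BirchSwinnertonDyer.BirchSwinnertonDyer.…` repeats a namespace BY DESIGN.
set_option linter.dupNamespace false

noncomputable section

namespace Summit.BirchSwinnertonDyer.BirchSwinnertonDyer.Theorems.TameQuarticManinParity

open Summit.BirchSwinnertonDyer.BirchSwinnertonDyer.Theses.TameQuarticManinParity

open scoped MatrixGroups NumberField
open Polynomial
open Literature.NumberTheory.GaloisRepresentations Literature.NumberTheory.EllipticCurves.ModularForms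

section Glue

/-- The integers of the coefficient field of a newform embed in the coefficient field. [folklore] -/
private lemma algebraMap_coeffCharIntegers_injective₃₅ {M : ℕ} [NeZero M]
    (g : CuspForm (CongruenceSubgroup.Gamma1 M) 2) :
    Function.Injective (algebraMap (coeffCharIntegers g) (coeffCharField g)) :=
  FaithfulSMul.algebraMap_injective (coeffCharIntegers g) (coeffCharField g)

/-- **G35 `TorsionRepOfEverywhereCongruentNewformOfRigid` (stmt-BirchSwinnertonDyer-23872), PROVED** — Deligne's theorem (the
tree's named fact `DeligneSerre1974.thm61_exists_adicGaloisRep`, λ-adic representation at EVERY finite place) ⇒ RIG35 ⇒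
CONG∞: the tree theorem `DeligneSerre1974.exists_isGaloisRepOfNewform1Int_semisimple_of_thm61` (weight `2`, `ℓ = 3`) yields
`ρ′ : Γ_ℚ → GL₂(k)` with `IsGaloisRepOfNewform1Int g ι_g {q ∣ 3M′} ρ′`; at `p ∤ 3N_W` the integral Hecke polynomial is
unique (`𝓞_g ↪ K_g`), so the everywhere-congruence hypothesis makes the Frobenius polynomial of `ρ′` equal to
`X² − a_p(W)X + p`; RIG35 gives `ρ′ = A (ρ ⊗_j k) A⁻¹`, and `isUnramifiedAt_conj_iff` / `hasFrobCharpolyAt_conj_iff`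
transport `IsGaloisRepOfNewform1Int` to `ρ ⊗_j k`.  Pen bsd-idea-3 g10, line35/Sketch35.lean.
[cite: DeligneSerreASENS1974, Thm. 6.1] -/
theorem torsionRepOfEverywhereCongruentNewform_of_rigid :
    TorsionRepOfEverywhereCongruentNewformOfRigid := by
  intro h61 hR W _ hirr k _ _ _ _ _ j M' _ hM' g ιg hnew hcong ρ hρ
  classical
  obtain ⟨ρ', hρ', -⟩ :=
    DeligneSerre1974.exists_isGaloisRepOfNewform1Int_semisimple_of_thm61 h61 (le_refl 2) hnew 3 ιg
  -- the data RIG35 wants, at every prime `p ∤ 3 N_W`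
  have hdata : ∀ v : IsDedekindDomain.HeightOneSpectrum (NumberField.RingOfIntegers ℚ),
      ¬ ((Rat.HeightOneSpectrum.primesEquiv v : Nat.Primes) : ℕ) ∣ 3 * W.conductorNorm ℤ →
        ρ'.IsUnramifiedAt v ∧
          ρ'.HasFrobCharpolyAt v
            (X ^ 2 - C ((W.LFunction ((Rat.HeightOneSpectrum.primesEquiv v : Nat.Primes) : ℕ) : ℤ) : k) * X
              + C ((((Rat.HeightOneSpectrum.primesEquiv v : Nat.Primes) : ℕ) : k))) := by
    intro v hv
    set p : ℕ := ((Rat.HeightOneSpectrum.primesEquiv v : Nat.Primes) : ℕ) with hp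
    have hpM : p ∉ {q : ℕ | q ∣ M' * 3} := by
      intro h
      exact hv (dvd_trans h (by rw [mul_comm]; exact mul_dvd_mul_left 3 hM'))
    obtain ⟨hur, P, hP, hch⟩ := hρ' v hpM
    refine ⟨hur, ?_⟩
    have hprime : p.Prime := (Rat.HeightOneSpectrum.primesEquiv v).2
    obtain ⟨P₂, hP₂, hP₂ι⟩ := hcong p hprime hv
    have hPP : P = P₂ :=
      Polynomial.map_injective _ (algebraMap_coeffCharIntegers_injective₃₅ g) (hP.trans hP₂.symm)
    rw [hPP, hP₂ι] at hch
    exact hch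
  obtain ⟨A, hA⟩ := hR W hirr k j ρ hρ ρ' hdata
  intro v hv
  obtain ⟨hur, P, hP, hch⟩ := hρ' v hv
  refine ⟨?_, P, hP, ?_⟩
  · rw [hA] at hur
    exact (FramedGaloisRep.isUnramifiedAt_conj_iff v A _).mp hur
  · rw [hA] at hch
    exact (FramedGaloisRep.hasFrobCharpolyAt_conj_iff v A _ _).mp hch

/-- **R35 `TorsionRepRigidOfFramedRepConjugate` (stmt-BirchSwinnertonDyer-23871), PROVED** — X35 ⇒ RIG35: take
`ρ₁ = ρ̄_{W,3} ⊗_j k` (irreducible by `BCDT.isAbsolutelyIrreducible_of_hasIrreducibleModPGaloisRep` +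
`FramedRep.toRepresentation_baseChange`), `N = 3 N_W`, and at `v ∤ 3 N_W` feed X35 the tree facts
`IsTorsionGaloisRep.isUnramifiedAt_of_hasGoodReductionAt`, `IsTorsionGaloisRep.charpoly_eq_of_isArithFrobAt` (with
`trace/det_galoisRepTate_frobenius_of_hasGoodReductionAt_holds`, `natCard_residueField_adicCompletionIntegers`,
`lFunction_primesEquiv_eq_frobeniusTraceAt`, `dvd_conductorNorm_iff`, `Rat.natCast_mem_asIdeal_iff`) pushed through
`FramedGaloisRep.isUnramifiedAt_baseChange_iff` / `hasFrobCharpolyAt_baseChange`.  Pen bsd-idea-3 g10, line35/Sketch35.lean.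
[cite: DarmonDiamondTaylor1995, §2.1, Prop. 2.6] -/
theorem torsionRepRigid_of_framedRepConjugate : TorsionRepRigidOfFramedRepConjugate := by
  intro hX W _ hirr k _ _ _ _ _ j ρ hρ ρ' hρ'
  classical
  haveI : Fact (Nat.Prime 3) := ⟨Nat.prime_three⟩
  haveI : NeZero (W.conductorNorm ℤ) := ⟨(W.conductorNorm_pos_holds).ne'⟩
  set ρk : FramedGaloisRep ℚ k 2 := FramedRep.baseChange j continuous_of_discreteTopology ρ with hρk
  -- `ρ̄ ⊗_j k` is irreducible (odd + irreducible ⇒ absolutely irreducible, DDT Thm. 3.1)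
  have hirrk : FramedRep.IsIrreducible ρk := by
    have habs := Literature.NumberTheory.Automorphic.BCDT.isAbsolutelyIrreducible_of_hasIrreducibleModPGaloisRep
      W (p := 3) (by norm_num) hirr hρ
    have h := habs k j
    rw [hρk, FramedRep.IsIrreducible, FramedRep.toRepresentation_baseChange]
    exact h
  have hne : 3 * W.conductorNorm ℤ ≠ 0 := mul_ne_zero three_ne_zero (NeZero.ne _)
  have hdata : ∀ v : IsDedekindDomain.HeightOneSpectrum (NumberField.RingOfIntegers ℚ),
      ¬ ((Rat.HeightOneSpectrum.primesEquiv v : Nat.Primes) : ℕ) ∣ 3 * W.conductorNorm ℤ →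
      ρk.IsUnramifiedAt v ∧ ρ'.IsUnramifiedAt v ∧
      ∃ P : Polynomial k, ρk.HasFrobCharpolyAt v P ∧ ρ'.HasFrobCharpolyAt v P := by
    intro v hv
    set p : ℕ := ((Rat.HeightOneSpectrum.primesEquiv v : Nat.Primes) : ℕ) with hpdef
    have hpp : p.Prime := (Rat.HeightOneSpectrum.primesEquiv v).2
    have hpdvd : ¬ p ∣ 3 * W.conductorNorm ℤ := hv
    obtain ⟨hur', hch'⟩ := hρ' v hpdvd
    have hp3 : p ≠ 3 := fun h ↦ hpdvd (by rw [h]; exact dvd_mul_right 3 _)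
    have hpN : ¬ p ∣ W.conductorNorm ℤ := fun h ↦ hpdvd (dvd_mul_of_dvd_right h 3)
    have hgood : W.HasGoodReductionAt v := by
      by_contra h
      exact hpN ((W.dvd_conductorNorm_iff v).mpr h)
    have hℓv : ((3 : ℕ) : NumberField.RingOfIntegers ℚ) ∉ v.asIdeal := by
      rw [Literature.NumberTheory.GaloisRepresentations.Rat.natCast_mem_asIdeal_iff]
      exact fun h ↦ hp3 ((Nat.prime_dvd_prime_iff_eq hpp Nat.prime_three).mp h)
    have hur : ρ.IsUnramifiedAt v := hρ.isUnramifiedAt_of_hasGoodReductionAt hgood hℓv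
    have hurk : ρk.IsUnramifiedAt v :=
      (FramedGaloisRep.isUnramifiedAt_baseChange_iff j continuous_of_discreteTopology j.injective v ρ).mpr hur
    have hch : ρ.HasFrobCharpolyAt v
        (X ^ 2 - C ((W.LFunction p : ℤ) : ZMod 3) * X + C ((p : ℕ) : ZMod 3)) := by
      intro 𝔓 h𝔓 σ hσ
      have h := hρ.charpoly_eq_of_isArithFrobAt
        (W.trace_galoisRepTate_frobenius_of_hasGoodReductionAt_holds 3)
        (W.det_galoisRepTate_frobenius_of_hasGoodReductionAt_holds 3) hℓv hgood h𝔓 hσ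
      rw [WeierstrassCurve.natCard_residueField_adicCompletionIntegers,
        ← W.lFunction_primesEquiv_eq_frobeniusTraceAt hgood] at h
      exact h
    have hchk := FramedGaloisRep.hasFrobCharpolyAt_baseChange j continuous_of_discreteTopology hch
    have e : (X ^ 2 - C ((W.LFunction p : ℤ) : ZMod 3) * X + C ((p : ℕ) : ZMod 3)).map j =
        X ^ 2 - C ((W.LFunction p : ℤ) : k) * X + C ((p : ℕ) : k) := by
      rw [Polynomial.map_add, Polynomial.map_sub, Polynomial.map_mul, Polynomial.map_pow, Polynomial.map_X,
        Polynomial.map_C, Polynomial.map_C, map_intCast, map_natCast]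
    rw [e] at hchk
    exact ⟨hurk, hur', _, hchk, hch'⟩
  obtain ⟨A, hA⟩ := hX k ρk ρ' hirrk (3 * W.conductorNorm ℤ) hne hdata
  exact ⟨A, hA⟩

end Glue

section Corollaries

/-- **RIG35 `TorsionRepRigidOfCongruentFrobenius` (stmt-BirchSwinnertonDyer-23870), PROVED outright**: the g-free rigidity of
`E[3] ⊗ k` by the Frobenius polynomials `X² − a_p(W) X + p` at the primes `p ∤ 3 N_W` — R35 applied to the landed X35
`framedRepConjugateOfCongruentFrobenius_proof` (p684226). [cite: DarmonDiamondTaylor1995, §2.1, Prop. 2.6] -/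
theorem torsionRepRigidOfCongruentFrobenius_proof : TorsionRepRigidOfCongruentFrobenius :=
  torsionRepRigid_of_framedRepConjugate framedRepConjugateOfCongruentFrobenius_proof

end Corollaries

end Summit.BirchSwinnertonDyer.BirchSwinnertonDyer.Theorems.TameQuarticManinParity

end
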